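import Summits.QuantumFields.BalabanUV.Gaps.EndDrawdownBand
import Summits.QuantumFields.BalabanUV.Gaps.CapTailPinnedLimitSign

/-!
# Gaps / EndBandDriftClass — THE BOUNDARY IS CLOSED IN A DRIFT CLASS: for a one-loop part `b` in a drift class `|Σ_{j<k} b_j − L·k| ≤ A` (row
# (D1)'s shape; every geometric rate is one) the quantified END readings over the remainder class `[−rlo, rhi]` are DECIDED at every threshold,
# boundary included — FORCED ⟺ `rlo ≤ L`, POSSIBLE ⟺ `−rhi ≤ L`, band ⟺ `−rhi ≤ L < rlo`; hence under (D1) AS TYPED, for ANY jet table,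
# FORCED ⟺ `rlo ≤ stepBal N Lc` (the slope clause of the tree's `endpointExistence_of_D1Drift` is EXACT over the class, equality allowed); and at
# the β-lead's PINNED LITERAL `JsBalAn1 …` — HYPOTHESIS-FREE through gan24-p1's all-scales rate as packaged by this seat's gen-5 file
# `CapTailPinnedLimitSign` — FORCED ⟺ `rlo ≤ M∞`, POSSIBLE ⟺ `−rhi ≤ M∞`, `M∞ := CauchyRate.lim β⁰_table`, and under (D1) there `M∞ = stepBal N Lc`
# (`CapTailPinnedLimitSign.d1Drift_pinned_iff_lim_eq`, by name); §0: the node under a GEOMETRIC RATE — the (e3)-shape at END grade (rate + ONE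
# certified coefficient + row (D4)'s constant, kernel §7 ∕ §8, B0-free).  A PORT into the tree, with attribution, of g1-plan-2 GEN 23–25's HOME kernel
# `HOME/g1/skeletons/B12Thm2SubDag_plan2.lean` v1.15 (sha16 6167da52388d3b3c) §12a (`…_lit_…`), §12c (lit), §14b–§14e, one-sided-first and with
# the literal's rate ∕ limit ∕ (D1)-identity taken BY NAME from the tree (cell pub-balaban-gaps, seat g1-p3 GEN 8, rows CAP ∕ tail «split ∕
# weakening»; file 5 of «the one-loop interface of the END statement»)

HONEST FRAMING (cell rule, page 1 of everything): two-line corollaries of `EndDrawdownBand`'s threshold theorems and `EndDrawdownSeq`'s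
drift-class lemma; hypothesis SHAPES; `EndForcedLU` ∕ `EndPossibleLU` are quantified READINGS of the cell's END-grade statement over Bałaban-free
data.  At the literal the rate is the tree's hypothesis-free theorem (gan24-p1 `allScalesSeq_secondMoment_JsBalAn1_pinned`), but NO VALUE OR SIGN
of `M∞`, of `stepBal N Lc − M∞`, or of any remainder constant is certified here (NODE-O instance 0∕1 — whether Bałaban's split is T0-pinned to this
table is row NODE-O ∕ (D1); CAP coefficients certified 0): the statements say WHICH inequality row (D4)'s lower constant must satisfy for the END
statement to be forced over the class, not that it holds.  AUTHORSHIP: mathematics g1-plan-2 GEN 23–25's (planner seat; «g1-p3 ports with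
attribution»); this seat: one-sided-first restatement, by-name wiring to `CapTailPinnedLimitSign`, header, docstrings, re-check.  Nothing of
Bałaban's asserted; 0∕6 binders; one finite T⁴; NOT [I] Thm 2, NOT `BetaPertH`, NOT the continuum limit, NOT Clay.

CITATION HEADER (tags CONTEXT ONLY).  [I] = T. Bałaban, Commun. Math. Phys. **109** (1987) 249–301 [Balaban1987RG1]: Thm 2 p. 259 (first
sentence), (1.6) p. 259 and (2.12)–(2.14) p. 268 (`β⁰_k → β̄`), (1.22) p. 264 (the second moment), §1 p. 264.
-/

namespace Summit.QuantumFields.BalabanUV.Gaps.EndBandDriftClass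

open Literature.MathematicalPhysics.QuantumFieldTheory.Balaban1983to89
open Literature.MathematicalPhysics.QuantumFieldTheory.Balaban1983to89.FlowStep
open Literature.MathematicalPhysics.QuantumFieldTheory.Balaban1983to89.FlowStepRuns
open Literature.MathematicalPhysics.QuantumFieldTheory.Balaban1983to89.DagBinding
open Literature.MathematicalPhysics.QuantumFieldTheory.Balaban1983to89.Beta
open Literature.MathematicalPhysics.QuantumFieldTheory.Balaban1983to89.Beta.Drift (OneLoopDrift)
open Literature.MathematicalPhysics.QuantumFieldTheory.Balaban1983to89.Beta.RemainderChain (RemainderConst)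
open Literature.MathematicalPhysics.QuantumFieldTheory.Balaban1983to89.Beta.RateCertificate (GeomRate CauchyRate)
open Literature.MathematicalPhysics.QuantumFieldTheory.Balaban1983to89.Beta.OneStepKernelFamily (TbalOf D1Drift)
open Literature.MathematicalPhysics.QuantumFieldTheory.Balaban1983to89.Beta.OneStepResolventKernel (JetData)
open Literature.MathematicalPhysics.QuantumFieldTheory.Balaban1983to89.Beta.AffineAveraging (box)
open Summit.QuantumFields.BalabanUV.Beta.MixedJetTablesPlug (JsBalAn1)
open Summit.QuantumFields.BalabanUV.Beta.GAN24.StencilSlotOfE3 (one_le_of_two_le)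
open Summit.QuantumFields.BalabanUV.Gaps.EndDrawdownSeq
open Summit.QuantumFields.BalabanUV.Gaps.EndDrawdownBand
open Summit.QuantumFields.BalabanUV.Gaps.CapTailPinnedLimitSign (exists_geomRate_pinned d1Drift_pinned_iff_lim_eq)
open Filter Topology Finset

noncomputable section

variable {Lc : ℕ} [NeZero Lc]

/-! ## §0 Node level under a GEOMETRIC RATE: the (e3)-shape at END grade (kernel §7 `End_of_geomRate_T2_T3` ∕ §8 `End_of_geomRate_oneCoeff_T2_T3`,
ported B0-free through the drawdown node) -/

/-- EDGE (rate at END grade) · fwd-gen ∧ a GEOMETRIC RATE `GeomRate β⁰ b∞ c₀ θ` (`0 ≤ θ < 1`, ANY limit value `b∞`) ∧ `RemainderConst Sβ γ₀ rr` with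
`rr ≤ b∞` ∧ (C) ⟹ `EndpointExistence` — the rate is a drift class at slope `b∞` (`GeomRate.drift`), so the node `DwSeq β⁰ rr` holds (boundary `rr = b∞`
included) and `EndDrawdownBand.endpointExistence_of_dwSeq_remainderConst` applies.  No (U), no `−β′ ≤ β`, no pin, no `stepBal`, no sign of any coefficient
(kernel §7 `End_of_geomRate_T2_T3`, B0-free). [cite: Balaban1987RG1, Thm 2 p.259 (first sentence) and (1.22) p.264] -/
theorem endpointExistence_of_geomRate_remainderConst {β : HBeta} {Cn : B12.Construction} (hgen : ForwardGenerated Cn β)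
    (Sβ : B12Beta.OneLoopSplit β) {binf c₀ θ rr γ₀ : ℝ} (hθ0 : 0 ≤ θ) (hθ1 : θ < 1) (hG : GeomRate Sβ.β0 binf c₀ θ) (hγ₀ : 0 < γ₀)
    (hrem : RemainderConst Sβ γ₀ rr) (hr : rr ≤ binf) (hcont : BetaContH γ₀ β) : EndpointExistence Cn :=
  endpointExistence_of_dwSeq_remainderConst hgen Sβ hγ₀ ((dwSeq_iff_of_geomRate hθ0 hθ1 hG rr).mpr hr) hrem hcont

/-- **THE (e3)-SHAPE AT END GRADE** · fwd-gen ∧ `GeomRate β⁰ b∞ c₀ θ` ∧ ONE certified coefficient `m ≤ β⁰_{k₁}` ∧ `RemainderConst Sβ γ₀ rr` with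
`rr ≤ m − c₀θ^{k₁}` ∧ (C) ⟹ `EndpointExistence` (`b∞ ≥ β⁰_{k₁} − c₀θ^{k₁} ≥ m − c₀θ^{k₁}`; no evaluation of `b∞`, no (U), no `−β′`, no depth clause, no `3∕4`;
kernel §8 `End_of_geomRate_oneCoeff_T2_T3`, B0-free). [cite: Balaban1987RG1, Thm 2 p.259 (first sentence) and (1.22) p.264] -/
theorem endpointExistence_of_geomRate_oneCoeff_remainderConst {β : HBeta} {Cn : B12.Construction} (hgen : ForwardGenerated Cn β)
    (Sβ : B12Beta.OneLoopSplit β) {binf c₀ θ m rr γ₀ : ℝ} {k₁ : ℕ} (hθ0 : 0 ≤ θ) (hθ1 : θ < 1) (hG : GeomRate Sβ.β0 binf c₀ θ)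
    (hcert : m ≤ Sβ.β0 k₁) (hγ₀ : 0 < γ₀) (hrem : RemainderConst Sβ γ₀ rr) (hr : rr ≤ m - c₀ * θ ^ k₁) (hcont : BetaContH γ₀ β) :
    EndpointExistence Cn := by
  have h1 := (abs_le.mp (hG k₁)).2
  exact endpointExistence_of_geomRate_remainderConst hgen Sβ hθ0 hθ1 hG hγ₀ hrem (by linarith) hcont

/-! ## §1 In a drift class every threshold is decided, boundary included (kernel §14c, ported one-sided) -/

/-- READING (drift class at slope `L`; `0 < γ₀`, nonempty box `−rlo ≤ rhi`) · over ALL realizations of `(b, [−rlo, rhi])` on the box: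
**E FORCED ⟺ `rlo ≤ L`** — the boundary `rlo = L` IS FORCED, whatever `rhi` (kernel §14c `EndForcedLU_iff_of_oneLoopDrift`).
[cite: Balaban1987RG1, Thm 2 p.259 (first sentence) and (1.22) p.264] -/
theorem endForcedLU_iff_of_oneLoopDrift {b : ℕ → ℝ} {L A rlo rhi γ₀ : ℝ} (hγ₀ : 0 < γ₀) (hc : -rlo ≤ rhi) (hA : OneLoopDrift L A b) :
    EndForcedLU b rlo rhi γ₀ ↔ rlo ≤ L := by
  rw [endForcedLU_iff_dwSeq hγ₀ hc, dwSeq_iff_of_oneLoopDrift hA]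

/-- READING (drift class) · `rlo ≤ L` ⟹ E FORCED, for EVERY box `[−rlo, rhi]` (nonemptiness not needed in this direction)
(kernel §14c `EndForced_of_oneLoopDrift_le`). [cite: Balaban1987RG1, Thm 2 p.259 (first sentence) and (1.22) p.264] -/
theorem endForcedLU_of_oneLoopDrift_le {b : ℕ → ℝ} {L A rlo γ₀ : ℝ} (rhi : ℝ) (hγ₀ : 0 < γ₀) (hA : OneLoopDrift L A b) (h : rlo ≤ L) :
    EndForcedLU b rlo rhi γ₀ :=
  endForcedLU_of_dwSeq rhi hγ₀ (dwSeq_of_oneLoopDrift hA h)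

/-- READING (drift class; `0 < γ₀`, `−rlo ≤ rhi`) · **E POSSIBLE ⟺ `−rhi ≤ L`** — the boundary `rhi = −L` IS POSSIBLE, whatever `rlo`
(kernel §14c `EndPossibleLU_iff_of_oneLoopDrift`). [cite: Balaban1987RG1, Thm 2 p.259 (first sentence) and (1.22) p.264] -/
theorem endPossibleLU_iff_of_oneLoopDrift {b : ℕ → ℝ} {L A rlo rhi γ₀ : ℝ} (hγ₀ : 0 < γ₀) (hc : -rlo ≤ rhi) (hA : OneLoopDrift L A b) :
    EndPossibleLU b rlo rhi γ₀ ↔ -rhi ≤ L := by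
  rw [endPossibleLU_iff_dwSeq_neg hγ₀ hc, dwSeq_iff_of_oneLoopDrift hA]

/-- READING (drift class) · THE UNDECIDED BAND IS EXACTLY `−rhi ≤ L < rlo`: E possible and not forced over the class ⟺ the slope lies in the half-open
remainder box — there E is decided by the remainder's signs (`EndDrawdownBand.band_realizations`), by nothing one-loop (kernel §14c `band_iff_of_oneLoopDrift`).
[cite: Balaban1987RG1, Thm 2 p.259 (first sentence) and (1.22) p.264] -/
theorem band_iff_of_oneLoopDrift {b : ℕ → ℝ} {L A rlo rhi γ₀ : ℝ} (hγ₀ : 0 < γ₀) (hc : -rlo ≤ rhi) (hA : OneLoopDrift L A b) :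
    (EndPossibleLU b rlo rhi γ₀ ∧ ¬ EndForcedLU b rlo rhi γ₀) ↔ (-rhi ≤ L ∧ L < rlo) := by
  rw [endPossibleLU_iff_of_oneLoopDrift hγ₀ hc hA, endForcedLU_iff_of_oneLoopDrift hγ₀ hc hA, not_le]

/-- READING (geometric rate to `L`, `0 ≤ θ < 1`; `0 < γ₀`, `−rlo ≤ rhi`) · E FORCED ⟺ `rlo ≤ L` — sharpens `EndBandStructure`'s convergent readings to a
decision at every threshold (kernel §14c `EndForced_iff_of_geomRate`). [cite: Balaban1987RG1, Thm 2 p.259 (first sentence) and (1.22) p.264] -/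
theorem endForcedLU_iff_of_geomRate {b : ℕ → ℝ} {L c₀ θ rlo rhi γ₀ : ℝ} (hγ₀ : 0 < γ₀) (hc : -rlo ≤ rhi) (hθ0 : 0 ≤ θ) (hθ1 : θ < 1)
    (hG : GeomRate b L c₀ θ) : EndForcedLU b rlo rhi γ₀ ↔ rlo ≤ L :=
  endForcedLU_iff_of_oneLoopDrift hγ₀ hc (hG.drift hθ0 hθ1)

/-- READING (geometric rate) · E POSSIBLE ⟺ `−rhi ≤ L` (kernel §14c `EndPossible_iff_of_geomRate`). [cite: Balaban1987RG1, Thm 2 p.259 (first sentence) and (1.22) p.264] -/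
theorem endPossibleLU_iff_of_geomRate {b : ℕ → ℝ} {L c₀ θ rlo rhi γ₀ : ℝ} (hγ₀ : 0 < γ₀) (hc : -rlo ≤ rhi) (hθ0 : 0 ≤ θ) (hθ1 : θ < 1)
    (hG : GeomRate b L c₀ θ) : EndPossibleLU b rlo rhi γ₀ ↔ -rhi ≤ L :=
  endPossibleLU_iff_of_oneLoopDrift hγ₀ hc (hG.drift hθ0 hθ1)

/-! ## §2 Under (D1) AS TYPED, any jet table: FORCED ⟺ `rlo ≤ stepBal N Lc` (kernel §14d, ported one-sided) -/

/-- READING UNDER ROW (D1)'s BINDER `D1Drift Lc Js N μ ν` (a drift class of the table's second moments at the printed slope `stepBal N Lc`), ANY jet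
family `Js` (`0 < γ₀`, `−rlo ≤ rhi`) · over ALL splits whose one-loop part IS the table (`Sβ.β0 j = secondMoment (TbalOf Lc Js j) μ ν` — the T0 pin
as a hypothesis of each realization) with remainder in `[−rlo, rhi]` on `]0,γ₀]`, (C), any forward-generated construction:
**E FORCED ⟺ `rlo ≤ stepBal N Lc`** — the slope clause `rr ≤ stepBal N Lc` of the tree's `Beta.OneStepKernelFamily.endpointExistence_of_D1Drift` is
EXACT over the class, equality allowed (kernel §14d `EndForced_table_iff_of_T1`). [cite: Balaban1987RG1, Thm 2 p.259 (first sentence) and (1.22) p.264] -/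
theorem endForcedLU_table_iff_of_d1Drift {Js : ℕ → JetData 3 Lc} {N : ℝ} {μ ν : Fin 4} (h1 : D1Drift Lc Js N μ ν) {rlo rhi γ₀ : ℝ}
    (hγ₀ : 0 < γ₀) (hc : -rlo ≤ rhi) :
    EndForcedLU (fun j => B12Beta.secondMoment (TbalOf Lc Js j) μ ν) rlo rhi γ₀ ↔ rlo ≤ B12Normalization.stepBal N Lc := by
  obtain ⟨A, hA⟩ := h1
  exact endForcedLU_iff_of_oneLoopDrift hγ₀ hc hA

/-- READING UNDER (D1), ANY TABLE · E POSSIBLE ⟺ `−rhi ≤ stepBal N Lc` (kernel §14d `EndPossible_table_iff_of_T1`).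
[cite: Balaban1987RG1, Thm 2 p.259 (first sentence) and (1.22) p.264] -/
theorem endPossibleLU_table_iff_of_d1Drift {Js : ℕ → JetData 3 Lc} {N : ℝ} {μ ν : Fin 4} (h1 : D1Drift Lc Js N μ ν) {rlo rhi γ₀ : ℝ}
    (hγ₀ : 0 < γ₀) (hc : -rlo ≤ rhi) :
    EndPossibleLU (fun j => B12Beta.secondMoment (TbalOf Lc Js j) μ ν) rlo rhi γ₀ ↔ -rhi ≤ B12Normalization.stepBal N Lc := by
  obtain ⟨A, hA⟩ := h1
  exact endPossibleLU_iff_of_oneLoopDrift hγ₀ hc hA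

/-- READING UNDER (D1), ANY TABLE · with `0 < N`, `2 ≤ Lc` (`stepBal_pos`) and `0 ≤ rhi`: E is POSSIBLE for EVERY remainder box — under (D1) the
cooperative realization always has E; FORCED is the located inequality `rlo ≤ stepBal N Lc` (kernel §14d `EndPossible_table_of_T1`).
[cite: Balaban1987RG1, Thm 2 p.259 (first sentence) and (1.22) p.264] -/
theorem endPossibleLU_table_of_d1Drift {Js : ℕ → JetData 3 Lc} {N : ℝ} {μ ν : Fin 4} (h1 : D1Drift Lc Js N μ ν) (hN : 0 < N)
    (hLc : 2 ≤ Lc) {rlo rhi γ₀ : ℝ} (hγ₀ : 0 < γ₀) (hc : -rlo ≤ rhi) (hrhi : 0 ≤ rhi) :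
    EndPossibleLU (fun j => B12Beta.secondMoment (TbalOf Lc Js j) μ ν) rlo rhi γ₀ := by
  have h1Lc : (1 : ℝ) < Lc := by exact_mod_cast Nat.lt_of_lt_of_le one_lt_two hLc
  have hpos := B12Normalization.stepBal_pos hN h1Lc
  exact (endPossibleLU_table_iff_of_d1Drift h1 hγ₀ hc).mpr (by linarith)

/-! ## §3 At the β-lead's pinned literal, HYPOTHESIS-FREE (kernel §12a ∕ §12c ∕ §14e, ported; the rate BY NAME from `CapTailPinnedLimitSign`) -/

/-- (lit) THE TABLE ITSELF LIES IN THE DRIFT CLASS OF SLOPE `M∞ := CauchyRate.lim β⁰_table`, hypothesis-free: this seat's gen-5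
`CapTailPinnedLimitSign.exists_geomRate_pinned` (gan24-p1's all-scales certificate ⟹ Cauchy rate ⟹ geometric rate at the limit) composed with
`GeomRate.drift` (kernel §14e `drift_lit`). [cite: Balaban1987RG1, (1.22) p.264 and (2.12)–(2.14) p.268] -/
theorem drift_pinned (hLc : 2 ≤ Lc) {r : Fin (3 + 1) → ℕ} (hr : r ∈ box (3 + 1) Lc) (cE cVH cΛ cB : ℝ)
    (Tc : Fin 4 → Fin 4 → Fin 4 → Fin 4 → ℝ) (μ ν : Fin 4) :
    ∃ A : ℝ, OneLoopDrift (CauchyRate.lim fun j =>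
        B12Beta.secondMoment (TbalOf Lc (JsBalAn1 (one_le_of_two_le hLc) hr cE cVH cΛ ((Lc : ℝ) ^ (2 * (3 + 1))) cB Tc) j) μ ν) A
      (fun j => B12Beta.secondMoment (TbalOf Lc (JsBalAn1 (one_le_of_two_le hLc) hr cE cVH cΛ ((Lc : ℝ) ^ (2 * (3 + 1))) cB Tc) j) μ ν) := by
  obtain ⟨c₀, θ, hθ0, hθ1, hG⟩ := exists_geomRate_pinned hLc hr cE cVH cΛ cB Tc μ ν
  exact ⟨_, hG.drift hθ0 hθ1⟩

/-- (lit) READING · `DwSeq β⁰_table rr ⟺ rr ≤ M∞` for EVERY real threshold (boundary included; kernel §14e `DwSeq_lit_iff`).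
[cite: Balaban1987RG1, (1.22) p.264 and (2.12)–(2.14) p.268] -/
theorem dwSeq_pinned_iff (hLc : 2 ≤ Lc) {r : Fin (3 + 1) → ℕ} (hr : r ∈ box (3 + 1) Lc) (cE cVH cΛ cB : ℝ)
    (Tc : Fin 4 → Fin 4 → Fin 4 → Fin 4 → ℝ) (μ ν : Fin 4) (rr : ℝ) :
    DwSeq (fun j => B12Beta.secondMoment (TbalOf Lc (JsBalAn1 (one_le_of_two_le hLc) hr cE cVH cΛ ((Lc : ℝ) ^ (2 * (3 + 1))) cB Tc) j) μ ν) rr ↔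
      rr ≤ CauchyRate.lim fun j =>
        B12Beta.secondMoment (TbalOf Lc (JsBalAn1 (one_le_of_two_le hLc) hr cE cVH cΛ ((Lc : ℝ) ^ (2 * (3 + 1))) cB Tc) j) μ ν := by
  obtain ⟨A, hA⟩ := drift_pinned hLc hr cE cVH cΛ cB Tc μ ν
  exact dwSeq_iff_of_oneLoopDrift hA rr

/-- (lit) READING (`0 < γ₀`, nonempty box `−rlo ≤ rhi`) · over ALL T0-pinned splits (`Sβ.β0 = β⁰_table`) with remainder in `[−rlo, rhi]` on `]0,γ₀]`,
(C), any forward-generated construction: **E FORCED ⟺ `rlo ≤ M∞`**, whatever `rhi` — the boundary `rlo = M∞` IS FORCED; the END-grade job of row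
(D4)'s LOWER remainder constant is exactly to sit on or below the one-loop limit (kernel §14e `EndForcedLU_lit_iff`).
[cite: Balaban1987RG1, Thm 2 p.259 (first sentence) and (1.22) p.264] -/
theorem endForcedLU_pinned_iff (hLc : 2 ≤ Lc) {r : Fin (3 + 1) → ℕ} (hr : r ∈ box (3 + 1) Lc) (cE cVH cΛ cB : ℝ)
    (Tc : Fin 4 → Fin 4 → Fin 4 → Fin 4 → ℝ) (μ ν : Fin 4) {rlo rhi γ₀ : ℝ} (hγ₀ : 0 < γ₀) (hc : -rlo ≤ rhi) :
    EndForcedLU (fun j => B12Beta.secondMoment (TbalOf Lc (JsBalAn1 (one_le_of_two_le hLc) hr cE cVH cΛ ((Lc : ℝ) ^ (2 * (3 + 1))) cB Tc) j) μ ν)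
        rlo rhi γ₀ ↔
      rlo ≤ CauchyRate.lim fun j =>
        B12Beta.secondMoment (TbalOf Lc (JsBalAn1 (one_le_of_two_le hLc) hr cE cVH cΛ ((Lc : ℝ) ^ (2 * (3 + 1))) cB Tc) j) μ ν := by
  obtain ⟨A, hA⟩ := drift_pinned hLc hr cE cVH cΛ cB Tc μ ν
  exact endForcedLU_iff_of_oneLoopDrift hγ₀ hc hA

/-- (lit) READING · `rlo ≤ M∞` ⟹ E FORCED over `[−rlo, rhi]` (every real `rlo`, every `rhi`; kernel §14e `EndForced_lit_of_le`).
[cite: Balaban1987RG1, Thm 2 p.259 (first sentence) and (1.22) p.264] -/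
theorem endForcedLU_pinned_of_le (hLc : 2 ≤ Lc) {r : Fin (3 + 1) → ℕ} (hr : r ∈ box (3 + 1) Lc) (cE cVH cΛ cB : ℝ)
    (Tc : Fin 4 → Fin 4 → Fin 4 → Fin 4 → ℝ) (μ ν : Fin 4) {rlo γ₀ : ℝ} (rhi : ℝ) (hγ₀ : 0 < γ₀)
    (h : rlo ≤ CauchyRate.lim fun j =>
      B12Beta.secondMoment (TbalOf Lc (JsBalAn1 (one_le_of_two_le hLc) hr cE cVH cΛ ((Lc : ℝ) ^ (2 * (3 + 1))) cB Tc) j) μ ν) :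
    EndForcedLU (fun j => B12Beta.secondMoment (TbalOf Lc (JsBalAn1 (one_le_of_two_le hLc) hr cE cVH cΛ ((Lc : ℝ) ^ (2 * (3 + 1))) cB Tc) j) μ ν)
      rlo rhi γ₀ := by
  obtain ⟨A, hA⟩ := drift_pinned hLc hr cE cVH cΛ cB Tc μ ν
  exact endForcedLU_of_oneLoopDrift_le rhi hγ₀ hA h

/-- (lit) READING (`0 < γ₀`, `−rlo ≤ rhi`) · **E POSSIBLE ⟺ `−rhi ≤ M∞`**, whatever `rlo` — the boundary IS POSSIBLE (kernel §14e `EndPossibleLU_lit_iff`).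
[cite: Balaban1987RG1, Thm 2 p.259 (first sentence) and (1.22) p.264] -/
theorem endPossibleLU_pinned_iff (hLc : 2 ≤ Lc) {r : Fin (3 + 1) → ℕ} (hr : r ∈ box (3 + 1) Lc) (cE cVH cΛ cB : ℝ)
    (Tc : Fin 4 → Fin 4 → Fin 4 → Fin 4 → ℝ) (μ ν : Fin 4) {rlo rhi γ₀ : ℝ} (hγ₀ : 0 < γ₀) (hc : -rlo ≤ rhi) :
    EndPossibleLU (fun j => B12Beta.secondMoment (TbalOf Lc (JsBalAn1 (one_le_of_two_le hLc) hr cE cVH cΛ ((Lc : ℝ) ^ (2 * (3 + 1))) cB Tc) j) μ ν)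
        rlo rhi γ₀ ↔
      -rhi ≤ CauchyRate.lim fun j =>
        B12Beta.secondMoment (TbalOf Lc (JsBalAn1 (one_le_of_two_le hLc) hr cE cVH cΛ ((Lc : ℝ) ^ (2 * (3 + 1))) cB Tc) j) μ ν := by
  obtain ⟨A, hA⟩ := drift_pinned hLc hr cE cVH cΛ cB Tc μ ν
  exact endPossibleLU_iff_of_oneLoopDrift hγ₀ hc hA

/-- (lit) READING (`0 < γ₀`, `−rlo ≤ rhi`) · THE BAND AT THE LITERAL IS EXACTLY `−rhi ≤ M∞ < rlo`: E possible and not forced over the T0-pinned class with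
remainder box `[−rlo, rhi]` ⟺ the one-loop limit lies in the half-open box (kernel §14e `band_lit_iff`). [cite: Balaban1987RG1, Thm 2 p.259 (first sentence) and (1.22) p.264] -/
theorem band_pinned_iff (hLc : 2 ≤ Lc) {r : Fin (3 + 1) → ℕ} (hr : r ∈ box (3 + 1) Lc) (cE cVH cΛ cB : ℝ)
    (Tc : Fin 4 → Fin 4 → Fin 4 → Fin 4 → ℝ) (μ ν : Fin 4) {rlo rhi γ₀ : ℝ} (hγ₀ : 0 < γ₀) (hc : -rlo ≤ rhi) :
    (EndPossibleLU (fun j => B12Beta.secondMoment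
          (TbalOf Lc (JsBalAn1 (one_le_of_two_le hLc) hr cE cVH cΛ ((Lc : ℝ) ^ (2 * (3 + 1))) cB Tc) j) μ ν) rlo rhi γ₀ ∧
      ¬ EndForcedLU (fun j => B12Beta.secondMoment
          (TbalOf Lc (JsBalAn1 (one_le_of_two_le hLc) hr cE cVH cΛ ((Lc : ℝ) ^ (2 * (3 + 1))) cB Tc) j) μ ν) rlo rhi γ₀) ↔
      (-rhi ≤ CauchyRate.lim (fun j =>
          B12Beta.secondMoment (TbalOf Lc (JsBalAn1 (one_le_of_two_le hLc) hr cE cVH cΛ ((Lc : ℝ) ^ (2 * (3 + 1))) cB Tc) j) μ ν) ∧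
        CauchyRate.lim (fun j =>
          B12Beta.secondMoment (TbalOf Lc (JsBalAn1 (one_le_of_two_le hLc) hr cE cVH cΛ ((Lc : ℝ) ^ (2 * (3 + 1))) cB Tc) j) μ ν) < rlo) := by
  obtain ⟨A, hA⟩ := drift_pinned hLc hr cE cVH cΛ cB Tc μ ν
  exact band_iff_of_oneLoopDrift hγ₀ hc hA

/-- (lit) UNDER (D1) AT THE LITERAL · `D1Drift` there ⟺ ONE REAL EQUATION `M∞ = stepBal N Lc` (this seat's gen-5
`CapTailPinnedLimitSign.d1Drift_pinned_iff_lim_eq`, BY NAME), so §2's decision `rlo ≤ stepBal N Lc` and §3's `rlo ≤ M∞` COINCIDE under (D1): over the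
T0-pinned class with box `[−rlo, rhi]`, E FORCED ⟺ `rlo ≤ stepBal N Lc` (kernel §14e `T1_lit_iff_lim_eq_stepBal` + `EndForced_lit_iff`).
[cite: Balaban1987RG1, Thm 2 p.259 (first sentence) and (1.22) p.264] -/
theorem endForcedLU_pinned_iff_of_d1Drift (hLc : 2 ≤ Lc) {r : Fin (3 + 1) → ℕ} (hr : r ∈ box (3 + 1) Lc) (cE cVH cΛ cB : ℝ)
    (Tc : Fin 4 → Fin 4 → Fin 4 → Fin 4 → ℝ) (μ ν : Fin 4) {N : ℝ}
    (hD : D1Drift Lc (JsBalAn1 (one_le_of_two_le hLc) hr cE cVH cΛ ((Lc : ℝ) ^ (2 * (3 + 1))) cB Tc) N μ ν) {rlo rhi γ₀ : ℝ}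
    (hγ₀ : 0 < γ₀) (hc : -rlo ≤ rhi) :
    EndForcedLU (fun j => B12Beta.secondMoment (TbalOf Lc (JsBalAn1 (one_le_of_two_le hLc) hr cE cVH cΛ ((Lc : ℝ) ^ (2 * (3 + 1))) cB Tc) j) μ ν)
        rlo rhi γ₀ ↔ rlo ≤ B12Normalization.stepBal N Lc := by
  rw [endForcedLU_pinned_iff hLc hr cE cVH cΛ cB Tc μ ν hγ₀ hc, (d1Drift_pinned_iff_lim_eq hLc hr cE cVH cΛ cB Tc μ ν N).mp hD]

end

end Summit.QuantumFields.BalabanUV.Gaps.EndBandDriftClass
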